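import Mathlib.CategoryTheory.Groupoid
import Mathlib.CategoryTheory.Equivalence
import Mathlib.CategoryTheory.InducedCategory

/-!
# [AbsTopIII] Definition 3.1 (vi): the category `Anab` and the equivalence `κ_An : 𝒯𝒢^sB ⥲ Anab`

S. Mochizuki, *Topics in absolute anabelian geometry III*, §3, Def. 3.1 (vi) p. 70 (bib key
`MochizukiAbsTopIII2015`; locators = kurims manuscript pages, lit key `paper:url-5493eb38cbb7`):
"Recall the 'image via the Kummer map of the multiplicative group of an algebraic closure of the base
field' `k̄^× ↪ lim→_J H¹(J, μ_Ẑ(Π))` … constructed via a purely 'group-theoretic' algorithm in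
Corollary 1.10, (d), (h), for `Π ∈ Ob(𝒯𝒢^sB)`.  Write `Anab` for the category whose objects are pairs
`(Π, Π ↷ {k̄^× ↪ lim→_J H¹(J, μ_Ẑ(Π))})` consisting of an object `Π ∈ Ob(𝒯𝒢^sB)`, together with the image
of the Kummer map …, equipped with its topological field structure and natural action via `Π` — all of
which is to be understood as constructed via the 'group-theoretic' algorithms of Corollary 1.10, (d),
(h) [cf. Remark 3.1.2] — and whose morphisms are the morphisms induced by isomorphisms of `𝒯𝒢^sB`.  Thus,
we obtain a natural functor `κ_An : 𝒯𝒢^sB → Anab` which [as is easily verified] is an equivalence of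
categories, a quasi-inverse for which is given by the natural projection functor `Anab → 𝒯𝒢^sB`."

TYPING (statements-first; policy θ of the abc-iut L4 plan, [AbsTopIII] Rmk. 1.9.8 "an algorithm = a
functor on abstract group data"): the group-theoretic algorithm of Cor. 1.10 (d), (h) is NOT yet in the
tree (seat abc-iut-L4-t1), so it enters as a PARAMETER — a functor `A : TG ⥤ D` on a groupoid `TG`
(`𝒯𝒢^sB` with its isomorphisms) valued in any category `D` (topological fields with group action and a
Kummer embedding).  Over it everything in (vi) is a REAL definition and the "easily verified" equivalence
is PROVED:

* `Anab A` — objects: pairs `(Π, F)` with `F = A(Π)` LITERALLY (field `data_eq`; cf. Rmk. 3.1.2: "the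
  algorithms of Corollary 1.10 form an essential portion of each object of `Anab`"); morphisms: induced by
  the morphisms (isomorphisms) of `TG` (`InducedCategory` along the projection);
* `Anab.proj : Anab A ⥤ TG` (the natural projection), `Anab.dataFunctor : Anab A ⥤ D` (the Kummer datum
  with its structure, functorially), `Anab.κAn : TG ⥤ Anab A`;
* `Anab.κAnEquivalence : TG ≌ Anab A` with functor `κ_An` and inverse the projection (`proj ⋙ κ_An ≅ 𝟭`
  by the identity of the underlying group; `κ_An ⋙ proj = 𝟭` on the nose), `Anab.κAn_isEquivalence`.

HONEST FRAMING: a definition and a formal verification; no anabelian content is asserted (the content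
is the parameter `A`, i.e. Cor. 1.10); nothing here bears on [IUTchIII] Cor. 3.12.
-/

namespace Literature.AnabelianGeometry.AbsoluteAnabelian

open CategoryTheory

universe v v' u u'

variable {TG : Type u} [Category.{v} TG] {D : Type u'} [Category.{v'} D]

/-- **Def 3.1 (vi): the category `Anab`** over a "group-theoretic algorithm" `A : 𝒯𝒢^sB ⥤ D` (Cor. 1.10
(d), (h): `Π ↦ (Π ↷ {k̄^× ↪ lim→_J H¹(J, μ_Ẑ(Π))})` with its topological field structure — a parameter
here): objects are pairs `(Π, F)` of an object `Π` of `𝒯𝒢^sB` and the datum `F = A(Π)` constructed from it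
(recorded with the equation, Rmk. 3.1.2). [cite: MochizukiAbsTopIII2015, Definition 3.1 (vi) p.70] -/
structure Anab (A : TG ⥤ D) : Type (max u u') where
  /-- the topological group `Π ∈ Ob(𝒯𝒢^sB)` -/
  grp : TG
  /-- the datum "`Π ↷ {k̄^× ↪ lim→_J H¹(J, μ_Ẑ(Π))}`" attached to `Π` … -/
  data : D
  /-- … which IS the output of the algorithm on `Π` -/
  data_eq : data = A.obj grp

namespace Anab

variable (A : TG ⥤ D)

/-- Morphisms of `Anab`: "the morphisms induced by [iso]morphisms of `𝒯𝒢^sB`" — a morphism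
`(Π, F) → (Π', F')` is a morphism `Π → Π'` of `𝒯𝒢^sB` (one-field structure).
[cite: MochizukiAbsTopIII2015, Definition 3.1 (vi) p.70] -/
@[ext]
structure Hom (X Y : Anab A) : Type v where
  /-- the underlying morphism of `𝒯𝒢^sB` -/
  hom : X.grp ⟶ Y.grp

/-- The category structure on `Anab` (induced along the projection `(Π, F) ↦ Π`).
[cite: MochizukiAbsTopIII2015, Definition 3.1 (vi) p.70] -/
instance category : Category.{v} (Anab A) where
  Hom X Y := Hom A X Y
  id X := ⟨𝟙 X.grp⟩
  comp f g := ⟨f.hom ≫ g.hom⟩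
  id_comp _ := Hom.ext (Category.id_comp _)
  comp_id _ := Hom.ext (Category.comp_id _)
  assoc _ _ _ := Hom.ext (Category.assoc _ _ _)

/-- Underlying morphism of an identity. [cite: MochizukiAbsTopIII2015, Definition 3.1 (vi) p.70] -/
@[simp] theorem id_hom (X : Anab A) : (𝟙 X : X ⟶ X).hom = 𝟙 X.grp := rfl

/-- Underlying morphism of a composite. [cite: MochizukiAbsTopIII2015, Definition 3.1 (vi) p.70] -/
@[simp] theorem comp_hom {X Y Z : Anab A} (f : X ⟶ Y) (g : Y ⟶ Z) : (f ≫ g).hom = f.hom ≫ g.hom := rfl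

/-- Two morphisms of `Anab` with the same underlying morphism are equal. [cite: MochizukiAbsTopIII2015, Definition 3.1 (vi) p.70] -/
@[ext] theorem hom_ext {X Y : Anab A} {f g : X ⟶ Y} (h : f.hom = g.hom) : f = g := Hom.ext h

/-- **The natural projection functor `Anab → 𝒯𝒢^sB`**, `(Π, F) ↦ Π`.
[cite: MochizukiAbsTopIII2015, Definition 3.1 (vi) p.70] -/
@[simps] def proj : Anab A ⥤ TG where
  obj X := X.grp
  map f := f.hom

/-- The datum `F = A(Π)` as a functor `Anab → D` ("equipped with its topological field structure and
natural action via `Π`", functorially in the inducing morphisms).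
[cite: MochizukiAbsTopIII2015, Definition 3.1 (vi) p.70] -/
def dataFunctor : Anab A ⥤ D := proj A ⋙ A

/-- **The natural functor `κ_An : 𝒯𝒢^sB → Anab`**, `Π ↦ (Π, A(Π))` ("executing the software" of Cor. 1.10
on `Π`, Rmk. 3.1.2). [cite: MochizukiAbsTopIII2015, Definition 3.1 (vi) p.70] -/
@[simps] def κAn : TG ⥤ Anab A where
  obj G := ⟨G, A.obj G, rfl⟩
  map f := ⟨f⟩

/-- `κ_An` followed by the projection is the identity of `𝒯𝒢^sB`, on the nose.
[cite: MochizukiAbsTopIII2015, Definition 3.1 (vi) p.70] -/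
theorem κAn_comp_proj : κAn A ⋙ proj A = 𝟭 TG := rfl

/-- The datum of `κ_An(Π)` is `A(Π)`: `κ_An ⋙ dataFunctor = A`.
[cite: MochizukiAbsTopIII2015, Definition 3.1 (vi) p.70] -/
theorem κAn_comp_dataFunctor : κAn A ⋙ dataFunctor A = A := rfl

/-- Every object of `Anab` is `κ_An` of its underlying group, up to the canonical (identity-induced)
isomorphism. [cite: MochizukiAbsTopIII2015, Definition 3.1 (vi) p.70] -/
@[simps] def isoκAnProj (X : Anab A) : (κAn A).obj X.grp ≅ X where
  hom := ⟨𝟙 X.grp⟩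
  inv := ⟨𝟙 X.grp⟩
  hom_inv_id := Hom.ext (Category.id_comp _)
  inv_hom_id := Hom.ext (Category.id_comp _)

/-- **Def 3.1 (vi): `κ_An : 𝒯𝒢^sB ⥲ Anab` is an equivalence of categories, with quasi-inverse the natural
projection** ("as is easily verified" — here: verified). [cite: MochizukiAbsTopIII2015, Definition 3.1 (vi) p.70] -/
def κAnEquivalence : TG ≌ Anab A where
  functor := κAn A
  inverse := proj A
  unitIso := Iso.refl _
  counitIso := NatIso.ofComponents (isoκAnProj A) (fun {X Y} f => Hom.ext (by
    change f.hom ≫ 𝟙 Y.grp = 𝟙 X.grp ≫ f.hom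
    rw [Category.comp_id, Category.id_comp]))
  functor_unitIso_comp X := Hom.ext (by
    change 𝟙 X ≫ 𝟙 X = 𝟙 X
    exact Category.id_comp _)

/-- `κ_An` is an equivalence. [cite: MochizukiAbsTopIII2015, Definition 3.1 (vi) p.70] -/
instance κAn_isEquivalence : (κAn A).IsEquivalence := (κAnEquivalence A).isEquivalence_functor

/-- The projection `Anab → 𝒯𝒢^sB` is an equivalence (the quasi-inverse).
[cite: MochizukiAbsTopIII2015, Definition 3.1 (vi) p.70] -/
instance proj_isEquivalence : (proj A).IsEquivalence := (κAnEquivalence A).isEquivalence_inverse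

end Anab

end Literature.AnabelianGeometry.AbsoluteAnabelian
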